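import Literature.MathematicalPhysics.QuantumFieldTheory.Balaban1983to89.Beta.ColourTraceAdjoint

/-!
# `Balaban1983to89.Beta.AveragedTransportVariance` — the second-jet defect of an AVERAGED adjoint transport is minus a Killing
# VARIANCE: `Σ_Γ w_Γ tr((ad B_Γ)²) − tr((ad B̄)²) = −Σ_Γ w_Γ ‖ad(B_Γ − B̄)‖²_F ≤ 0`, with equality iff the transported letters agree — the
# closed form and the sign behind «a contour-averaged B-independent slice is NOT unipotent» (β sub-cell of `pub-balaban`, row BETA-lit1 =
# the transfer / normalisation / colour-dictionary seat, gen 22; written on the β-lead's SLICE-FP-NOTE v0.5 §9 / IDENT-122 CHECK ITEM (D-h′))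

HONEST FRAMING (cell rule, verbatim): discharging `BetaPertH` makes Bałaban's UV stability UNCONDITIONAL — a real constructive-QFT
result; it is NOT the continuum limit and NOT the Clay problem.  THIS MODULE DISCHARGES NOTHING of the series, instantiates no binder of
the wall, and asserts nothing about Bałaban's own averaging functionals `M` (B12 (0.11), which are background-DEPENDENT, right-covariant
and unipotent by (0.15)); it is finite-dimensional linear algebra over an ARBITRARY generator family and ARBITRARY letters — a kernel
certificate of WHY route (α) of RULING (R29) dresses the typed jets by SINGLE block trees.  NOT summit progress.

ABSOLUTE RULE (cell charter, verbatim in substance).  No internally-minted statement enters as a cited fact: every hypothesis below is a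
real-weight condition (`0 ≤ w`, `Σ w = 1`), one of the family predicates `ColourTrace.Complete` (a definition asserting nothing),
Hermiticity, or `N ≠ 0`, and every conclusion is kernel-proved here from Mathlib and `Beta.ColourTrace` / `Beta.ColourTraceAdjoint`;
NOTHING is cited as a fact; no `def … : Prop` occurs.

THE OBJECT (cell journal: β-lead RULING (R29) 2026-08-19T16:05Z and CHECK ITEM (D-h′) «LATTICE SYMMETRY OF THE DRESSED FAMILY», lead note
`SLICE-FP-NOTE.md` v0.5 §9 with the toy `slice_fp_toy5.py`).  For a sharp gauge slice that reads, at each non-centre site `x` of a block,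
the AVERAGE over a contour set `G(y,x)` of the line sums of the fluctuation field, the slice composed with the linearised residual gauge
orbit map `(D_B λ)_b = λ(x) − Ad(U_b(B)) λ(x′)` is block-triangular in `|x − y|₁` with diagonal blocks `A_x(B) = −avg_Γ Ad(U_{b_last(Γ)}(B))`
(the lead's §9), i.e. along `B ↦ tB`, `A_x(t) = −Σ_Γ w_Γ exp(t·ad B_Γ)` with `ad B_Γ` the (real, antisymmetric) adjoint-action matrix of
the letter transported on the last bond of `Γ`.  By Jacobi's second-order formula (tree `Beta.LogDetHessian.fderiv_fderiv_log_det`: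
`∂² log det A = tr(A₀⁻¹ ∂²A) − tr((A₀⁻¹ ∂A)²)` at an invertible `A₀`; here `A₀ = ∓1`, `∂A = ∓ad B̄`, `∂²A = ∓Σ_Γ w_Γ (ad B_Γ)²`,
`B̄ := Σ_Γ w_Γ B_Γ`) the second jet of `f(t) = log|det(τ_avg·D_{tB})|` is
    `f″(0) = Σ_x [ Σ_Γ w_Γ tr((ad B_Γ)²) − tr((ad B̄_x)²) ] = Σ_x avgDefect`.
THIS FILE proves, for the bracket `avgDefect` (§2) — with NO hypothesis on the generator family `τ` or on the letters —
  (V)  `avgDefect = Σ_Γ w_Γ tr((ad(B_Γ − B̄))²) = −Σ_Γ w_Γ ‖ad(B_Γ − B̄)‖²_F ≤ 0`   (`avgDefect_eq_variance`, `avgDefect_eq_neg_frob`,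
       `avgDefect_nonpos`; the variance identity for the trace form + the antisymmetry `ColourTrace.adMat_transpose`),
  (Z)  `avgDefect = 0 ↔ ∀ Γ, w_Γ ≠ 0 → ad B_Γ = ad B̄`   (`avgDefect_eq_zero_iff`) — a SINGLE contour (or equal transported letters)
       gives `0` (`avgDefect_const`): single-tree slices are unipotent to second order, as `Beta.TreeSliceUnipotent` proves exactly;
  (Z′) (v1.1, §5) over a COMPLETE Hermitian family with `N ≠ 0` and traceless Hermitian letters, `ad` is faithful (`eq_of_adMat_eq`: equal
       `adMat` and equal trace ⇒ equal letters, via `ColourTrace.ibr_gen_eq_sum` / `expansion_of_complete` and Mathlib's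
       `Matrix.mem_range_scalar_iff_commute_single'`), so `avgDefect = 0 ↔ ∀ Γ, w_Γ ≠ 0 → B_Γ = B̄` (`avgDefect_eq_zero_iff_letters`),
  (S)  (v1.1, §5) `avgDefect(B + Y₀) = avgDefect(B)` on `Σ w = 1` alone (`avgDefect_add_const`): the defect sees only letter differences,
and, for Hermitian letters over a complete Hermitian family with `N ≠ 0` (`ColourTrace.trace_adMat_mul`),
  (K)  `avgDefect = Σ_Γ w_Γ [ −2N·Re Tr((B_Γ − B̄)²) + 2·(Re Tr(B_Γ − B̄))² ]`, `= −2N·Σ_Γ w_Γ Re Tr((B_Γ − B̄)²)` for traceless letters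
       (`avgDefect_eq_killing`, `avgDefect_eq_killing_traceless`): minus `2N` × the Killing VARIANCE of the transported letters over
       the contour set — a derivative-free, negative-semidefinite quadratic form in the background.
So a background-INDEPENDENT contour-averaged sharp slice is unipotent to second order at `B = 0` iff at every site the letters on
the last bonds of the averaged contours coincide; generically (two or more contours, independent bond letters) it is not, and the omitted
Faddeev–Popov quotient is a «mass-like» term — the quantitative content of (D-h′).

TWO-ENGINE RECORD (cell discipline; numbers are EVIDENCE, not inputs): in the lead's toy (su(2) ≅ so(3) letters, `tr(K_vK_w) = −2 v·w`,
all shortest lattice paths averaged with equal weights) the closed form `−2·Σ_x Var_Γ(v_Γ)` (`v_Γ` = the letter of the last bond of `Γ`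
for a positively oriented last step, `0` for a negatively oriented one) reproduces the toy's finite-difference `f″(0)` to relative
`≤ 2.5·10⁻⁷` on `(seed, L, d) = (7,3,2), (7,5,2), (7,3,3), (11,3,2), (3,5,2)`: `−5.317558 / −20.92266 / −39.63954 / −5.232253 / −27.93034`
(cell archive `b2b-balaban-beta-lit1/gen22/avgslice/`).

References: none cited (all [folklore]); context as in `Beta.ColourTrace`.  Cell records: journal CLAIM BETA-lit1-g22-AVG-TRANSPORT-VARIANCE;
GAPS C-lit1g22-3 (v1), cross-read C-pv14-112 (v1: ok, DOCFIX 0), C-lit1g22-4 (v1.1 = v1 verbatim + §5 appended).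
-/

namespace Literature.MathematicalPhysics.QuantumFieldTheory.Balaban1983to89.Beta.AveragedTransportVariance

open Matrix Complex
open scoped BigOperators
open Literature.MathematicalPhysics.QuantumFieldTheory.Balaban1983to89.Beta.ColourTrace
open Literature.MathematicalPhysics.QuantumFieldTheory.Balaban1983to89.Beta.ColourTraceAdjoint (adMatC_add adMatC_smul)

/-! ## §1 Real matrices: the Frobenius square-sum, the trace form, and the variance identity -/

section RealMatrices

variable {m K : Type*} [Fintype m]

/-- the Frobenius square-sum `‖A‖²_F = Σ_{ij} A_{ij}²` of a real square matrix. [folklore] -/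
def frob (A : Matrix m m ℝ) : ℝ := ∑ i, ∑ j, A i j ^ 2

/-- `‖A‖²_F ≥ 0`. [folklore] -/
theorem frob_nonneg (A : Matrix m m ℝ) : 0 ≤ frob A :=
  Finset.sum_nonneg fun i _ => Finset.sum_nonneg fun j _ => sq_nonneg (A i j)

/-- `‖A‖²_F = 0 ↔ A = 0`. [folklore] -/
theorem frob_eq_zero_iff (A : Matrix m m ℝ) : frob A = 0 ↔ A = 0 := by
  constructor
  · intro h
    ext i j
    have hi : ∑ j, A i j ^ 2 = 0 := by
      have := (Finset.sum_eq_zero_iff_of_nonneg fun i _ => Finset.sum_nonneg fun j _ => sq_nonneg (A i j)).mp h i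
        (Finset.mem_univ i)
      exact this
    have hij : A i j ^ 2 = 0 := (Finset.sum_eq_zero_iff_of_nonneg fun j _ => sq_nonneg (A i j)).mp hi j (Finset.mem_univ j)
    simpa using hij
  · rintro rfl
    simp [frob]

/-- `tr(AᵀA) = ‖A‖²_F`. [folklore] -/
theorem trace_transpose_mul_self (A : Matrix m m ℝ) : (Aᵀ * A).trace = frob A := by
  simp only [Matrix.trace, Matrix.diag_apply, Matrix.mul_apply, Matrix.transpose_apply, frob, pow_two]
  rw [Finset.sum_comm]

/-- for an ANTISYMMETRIC real matrix, `tr(A²) = −‖A‖²_F`. [folklore] -/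
theorem trace_mul_self_of_transpose_eq_neg {A : Matrix m m ℝ} (h : Aᵀ = -A) : (A * A).trace = -frob A := by
  rw [← trace_transpose_mul_self, h, Matrix.neg_mul, Matrix.trace_neg, neg_neg]

/-- THE VARIANCE IDENTITY for a real bilinear form: with weights summing to `1` and the weighted mean `x̄ = Σ w_k • x_k`,
`Σ_k w_k φ(x_k, x_k) − φ(x̄, x̄) = Σ_k w_k φ(x_k − x̄, x_k − x̄)`. [folklore] -/
theorem bilin_variance {M : Type*} [AddCommGroup M] [Module ℝ M] (φ : M →ₗ[ℝ] M →ₗ[ℝ] ℝ) (s : Finset K) (w : K → ℝ)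
    (x : K → M) (hw : ∑ k ∈ s, w k = 1) :
    ∑ k ∈ s, w k * φ (x k) (x k) - φ (∑ k ∈ s, w k • x k) (∑ k ∈ s, w k • x k)
      = ∑ k ∈ s, w k * φ (x k - ∑ j ∈ s, w j • x j) (x k - ∑ j ∈ s, w j • x j) := by
  have e1 : ∑ k ∈ s, w k * φ (x k) (∑ j ∈ s, w j • x j) = φ (∑ j ∈ s, w j • x j) (∑ j ∈ s, w j • x j) := by
    have h : φ (∑ j ∈ s, w j • x j) (∑ j ∈ s, w j • x j) = ∑ k ∈ s, φ (w k • x k) (∑ j ∈ s, w j • x j) :=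
      LinearMap.map_sum₂ φ s (fun k => w k • x k) _
    rw [h]
    exact Finset.sum_congr rfl fun k _ => by rw [LinearMap.map_smul₂, smul_eq_mul]
  have e2 : ∑ k ∈ s, w k * φ (∑ j ∈ s, w j • x j) (x k) = φ (∑ j ∈ s, w j • x j) (∑ j ∈ s, w j • x j) := by
    have h : φ (∑ j ∈ s, w j • x j) (∑ j ∈ s, w j • x j) = ∑ k ∈ s, φ (∑ j ∈ s, w j • x j) (w k • x k) :=
      map_sum (φ (∑ j ∈ s, w j • x j)) (fun k => w k • x k) s
    rw [h]
    exact Finset.sum_congr rfl fun k _ => by rw [map_smul, smul_eq_mul]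
  have e3 : ∑ k ∈ s, w k * φ (∑ j ∈ s, w j • x j) (∑ j ∈ s, w j • x j) = φ (∑ j ∈ s, w j • x j) (∑ j ∈ s, w j • x j) := by
    rw [← Finset.sum_mul, hw, one_mul]
  have e4 : ∀ k ∈ s, w k * φ (x k - ∑ j ∈ s, w j • x j) (x k - ∑ j ∈ s, w j • x j)
      = w k * φ (x k) (x k) - w k * φ (x k) (∑ j ∈ s, w j • x j) - w k * φ (∑ j ∈ s, w j • x j) (x k)
        + w k * φ (∑ j ∈ s, w j • x j) (∑ j ∈ s, w j • x j) := by
    intro k _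
    simp only [map_sub, LinearMap.sub_apply]
    ring
  rw [Finset.sum_congr rfl e4, Finset.sum_add_distrib, Finset.sum_sub_distrib, Finset.sum_sub_distrib, e1, e2, e3]
  ring

/-- the TRACE FORM `(X, Y) ↦ tr(XY)` on real square matrices, as a bilinear map. [folklore] -/
noncomputable def trForm : Matrix m m ℝ →ₗ[ℝ] Matrix m m ℝ →ₗ[ℝ] ℝ :=
  LinearMap.mk₂ ℝ (fun X Y => (X * Y).trace)
    (fun X X' Y => by simp only [Matrix.add_mul, Matrix.trace_add])
    (fun r X Y => by simp only [Matrix.smul_mul, Matrix.trace_smul, smul_eq_mul])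
    (fun X Y Y' => by simp only [Matrix.mul_add, Matrix.trace_add])
    (fun r X Y => by simp only [Matrix.mul_smul, Matrix.trace_smul, smul_eq_mul])

/-- unfolding of the trace form. [folklore] -/
theorem trForm_apply (X Y : Matrix m m ℝ) : trForm X Y = (X * Y).trace := rfl

/-- THE VARIANCE IDENTITY FOR TRACES OF SQUARES: `Σ_k w_k tr(A_k²) − tr(Ā²) = Σ_k w_k tr((A_k − Ā)²)`, `Ā = Σ w_k • A_k`, `Σ w = 1`.
[folklore] -/
theorem trace_sq_variance (s : Finset K) (w : K → ℝ) (A : K → Matrix m m ℝ) (hw : ∑ k ∈ s, w k = 1) :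
    ∑ k ∈ s, w k * (A k * A k).trace - ((∑ k ∈ s, w k • A k) * (∑ k ∈ s, w k • A k)).trace
      = ∑ k ∈ s, w k * ((A k - ∑ j ∈ s, w j • A j) * (A k - ∑ j ∈ s, w j • A j)).trace := by
  have h := bilin_variance (trForm (m := m)) s w A hw
  simpa only [trForm_apply] using h

omit [Fintype m] in
/-- a weighted mean of antisymmetric matrices is antisymmetric. [folklore] -/
theorem transpose_sum_smul_eq_neg (s : Finset K) (w : K → ℝ) (A : K → Matrix m m ℝ) (hA : ∀ k ∈ s, (A k)ᵀ = -A k) :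
    (∑ k ∈ s, w k • A k)ᵀ = -∑ k ∈ s, w k • A k := by
  rw [Matrix.transpose_sum, ← Finset.sum_neg_distrib]
  refine Finset.sum_congr rfl fun k hk => ?_
  rw [Matrix.transpose_smul, hA k hk, smul_neg]

/-- **SIGN**: for antisymmetric `A_k` and weights `w ≥ 0` summing to `1`, `Σ_k w_k tr(A_k²) − tr(Ā²) = −Σ_k w_k ‖A_k − Ā‖²_F`. [folklore] -/
theorem trace_sq_variance_eq_neg_frob (s : Finset K) (w : K → ℝ) (A : K → Matrix m m ℝ) (hw : ∑ k ∈ s, w k = 1)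
    (hA : ∀ k ∈ s, (A k)ᵀ = -A k) :
    ∑ k ∈ s, w k * (A k * A k).trace - ((∑ k ∈ s, w k • A k) * (∑ k ∈ s, w k • A k)).trace
      = -∑ k ∈ s, w k * frob (A k - ∑ j ∈ s, w j • A j) := by
  rw [trace_sq_variance s w A hw, ← Finset.sum_neg_distrib]
  refine Finset.sum_congr rfl fun k hk => ?_
  have hT : (A k - ∑ j ∈ s, w j • A j)ᵀ = -(A k - ∑ j ∈ s, w j • A j) := by
    rw [Matrix.transpose_sub, hA k hk, transpose_sum_smul_eq_neg s w A hA, neg_sub_neg, neg_sub]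
  rw [trace_mul_self_of_transpose_eq_neg hT]
  ring

/-- … hence it is `≤ 0`. [folklore] -/
theorem trace_sq_variance_nonpos (s : Finset K) (w : K → ℝ) (A : K → Matrix m m ℝ) (hw : ∑ k ∈ s, w k = 1)
    (hw0 : ∀ k ∈ s, 0 ≤ w k) (hA : ∀ k ∈ s, (A k)ᵀ = -A k) :
    ∑ k ∈ s, w k * (A k * A k).trace - ((∑ k ∈ s, w k • A k) * (∑ k ∈ s, w k • A k)).trace ≤ 0 := by
  rw [trace_sq_variance_eq_neg_frob s w A hw hA, neg_nonpos]
  exact Finset.sum_nonneg fun k hk => mul_nonneg (hw0 k hk) (frob_nonneg _)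

/-- … and it VANISHES iff every weighted matrix equals the mean. [folklore] -/
theorem trace_sq_variance_eq_zero_iff (s : Finset K) (w : K → ℝ) (A : K → Matrix m m ℝ) (hw : ∑ k ∈ s, w k = 1)
    (hw0 : ∀ k ∈ s, 0 ≤ w k) (hA : ∀ k ∈ s, (A k)ᵀ = -A k) :
    ∑ k ∈ s, w k * (A k * A k).trace - ((∑ k ∈ s, w k • A k) * (∑ k ∈ s, w k • A k)).trace = 0
      ↔ ∀ k ∈ s, w k ≠ 0 → A k = ∑ j ∈ s, w j • A j := by
  rw [trace_sq_variance_eq_neg_frob s w A hw hA, neg_eq_zero,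
    Finset.sum_eq_zero_iff_of_nonneg fun k hk => mul_nonneg (hw0 k hk) (frob_nonneg _)]
  refine forall₂_congr fun k hk => ?_
  rw [mul_eq_zero, frob_eq_zero_iff, sub_eq_zero]
  tauto

end RealMatrices

/-! ## §2 The defect of an averaged adjoint transport (no hypothesis on the generator family or on the letters) -/

section Defect

variable {N : ℕ} {C K : Type*} [Fintype C]

omit [Fintype C] in
/-- `adMat` is additive in the letter. [folklore] -/
theorem adMat_add (τ : C → Matrix (Fin N) (Fin N) ℂ) (X Y : Matrix (Fin N) (Fin N) ℂ) :
    adMat τ (X + Y) = adMat τ X + adMat τ Y := by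
  ext c d
  simp only [adMat_apply, adMatC_add, Matrix.add_apply, Complex.add_re]

omit [Fintype C] in
/-- `adMat` is ℝ-homogeneous in the letter. [folklore] -/
theorem adMat_smul (τ : C → Matrix (Fin N) (Fin N) ℂ) (r : ℝ) (X : Matrix (Fin N) (Fin N) ℂ) :
    adMat τ (r • X) = r • adMat τ X := by
  ext c d
  have h : (r • X : Matrix (Fin N) (Fin N) ℂ) = (r : ℂ) • X := by
    ext i j
    simp only [Matrix.smul_apply, Complex.real_smul, smul_eq_mul]
  simp only [adMat_apply, h, adMatC_smul, Matrix.smul_apply, smul_eq_mul, Complex.re_ofReal_mul]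

omit [Fintype C] in
/-- `adMat` is ℝ-additive over finite sums. [folklore] -/
theorem adMat_sum (τ : C → Matrix (Fin N) (Fin N) ℂ) (s : Finset K) (Y : K → Matrix (Fin N) (Fin N) ℂ) :
    adMat τ (∑ k ∈ s, Y k) = ∑ k ∈ s, adMat τ (Y k) := by
  classical
  induction s using Finset.induction_on with
  | empty =>
    ext c d
    simp [adMat_apply, adMatC_apply]
  | insert k s hk ih => rw [Finset.sum_insert hk, Finset.sum_insert hk, adMat_add, ih]

omit [Fintype C] in
/-- `adMat` of a real weighted mean is the weighted mean of the `adMat`'s. [folklore] -/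
theorem adMat_sum_smul (τ : C → Matrix (Fin N) (Fin N) ℂ) (s : Finset K) (w : K → ℝ) (X : K → Matrix (Fin N) (Fin N) ℂ) :
    adMat τ (∑ k ∈ s, w k • X k) = ∑ k ∈ s, w k • adMat τ (X k) := by
  rw [adMat_sum]
  exact Finset.sum_congr rfl fun k _ => adMat_smul τ (w k) (X k)

omit [Fintype C] in
/-- `adMat` is subtractive in the letter. [folklore] -/
theorem adMat_sub (τ : C → Matrix (Fin N) (Fin N) ℂ) (X Y : Matrix (Fin N) (Fin N) ℂ) :
    adMat τ (X - Y) = adMat τ X - adMat τ Y := by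
  rw [sub_eq_add_neg, adMat_add, ← neg_one_smul ℝ Y, adMat_smul, neg_one_smul, ← sub_eq_add_neg]

/-- **THE SECOND-JET DEFECT OF AN AVERAGED ADJOINT TRANSPORT**: for letters `X_k` transported on the last bonds of the averaged
contours with weights `w_k`, `avgDefect τ s w X := Σ_k w_k tr((adMat τ X_k)²) − tr((adMat τ X̄)²)`, `X̄ = Σ_k w_k • X_k` — by Jacobi's
second-order formula the `t²`-jet of `log|det|` of the diagonal block `Σ_k w_k exp(t·adMat τ X_k)` (header).  A definition asserting
nothing. [folklore] -/
noncomputable def avgDefect (τ : C → Matrix (Fin N) (Fin N) ℂ) (s : Finset K) (w : K → ℝ) (X : K → Matrix (Fin N) (Fin N) ℂ) : ℝ :=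
  ∑ k ∈ s, w k * (adMat τ (X k) * adMat τ (X k)).trace
    - (adMat τ (∑ k ∈ s, w k • X k) * adMat τ (∑ k ∈ s, w k • X k)).trace

/-- (V) **THE DEFECT IS A VARIANCE**: `avgDefect = Σ_k w_k tr((adMat τ (X_k − X̄))²)` (`Σ w = 1`; no hypothesis on `τ`, `X`). [folklore] -/
theorem avgDefect_eq_variance (τ : C → Matrix (Fin N) (Fin N) ℂ) (s : Finset K) (w : K → ℝ) (X : K → Matrix (Fin N) (Fin N) ℂ)
    (hw : ∑ k ∈ s, w k = 1) :
    avgDefect τ s w X = ∑ k ∈ s, w k * (adMat τ (X k - ∑ j ∈ s, w j • X j) * adMat τ (X k - ∑ j ∈ s, w j • X j)).trace := by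
  unfold avgDefect
  rw [adMat_sum_smul, trace_sq_variance s w (fun k => adMat τ (X k)) hw]
  refine Finset.sum_congr rfl fun k _ => ?_
  rw [adMat_sub, adMat_sum_smul]

/-- (V) **… AND IT IS MINUS A FROBENIUS SQUARE-SUM**: `avgDefect = −Σ_k w_k ‖adMat τ (X_k − X̄)‖²_F` (the `adMat`'s are antisymmetric for
EVERY `τ`, `X`: `ColourTrace.adMat_transpose`). [folklore] -/
theorem avgDefect_eq_neg_frob (τ : C → Matrix (Fin N) (Fin N) ℂ) (s : Finset K) (w : K → ℝ) (X : K → Matrix (Fin N) (Fin N) ℂ)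
    (hw : ∑ k ∈ s, w k = 1) :
    avgDefect τ s w X = -∑ k ∈ s, w k * frob (adMat τ (X k - ∑ j ∈ s, w j • X j)) := by
  rw [avgDefect_eq_variance τ s w X hw, ← Finset.sum_neg_distrib]
  refine Finset.sum_congr rfl fun k _ => ?_
  rw [trace_mul_self_of_transpose_eq_neg (adMat_transpose τ _)]
  ring

/-- (V) **SIGN**: `avgDefect ≤ 0` for weights `w ≥ 0` summing to `1` — for EVERY generator family and EVERY letters. [folklore] -/
theorem avgDefect_nonpos (τ : C → Matrix (Fin N) (Fin N) ℂ) (s : Finset K) (w : K → ℝ) (X : K → Matrix (Fin N) (Fin N) ℂ)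
    (hw : ∑ k ∈ s, w k = 1) (hw0 : ∀ k ∈ s, 0 ≤ w k) : avgDefect τ s w X ≤ 0 := by
  rw [avgDefect_eq_neg_frob τ s w X hw, neg_nonpos]
  exact Finset.sum_nonneg fun k hk => mul_nonneg (hw0 k hk) (frob_nonneg _)

/-- (Z) **THE EQUALITY CASE**: `avgDefect = 0` iff every weighted transport matrix equals the mean one,
`adMat τ X_k = adMat τ X̄` whenever `w_k ≠ 0`. [folklore] -/
theorem avgDefect_eq_zero_iff (τ : C → Matrix (Fin N) (Fin N) ℂ) (s : Finset K) (w : K → ℝ) (X : K → Matrix (Fin N) (Fin N) ℂ)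
    (hw : ∑ k ∈ s, w k = 1) (hw0 : ∀ k ∈ s, 0 ≤ w k) :
    avgDefect τ s w X = 0 ↔ ∀ k ∈ s, w k ≠ 0 → adMat τ (X k) = adMat τ (∑ j ∈ s, w j • X j) := by
  rw [avgDefect_eq_neg_frob τ s w X hw, neg_eq_zero,
    Finset.sum_eq_zero_iff_of_nonneg fun k hk => mul_nonneg (hw0 k hk) (frob_nonneg _)]
  refine forall₂_congr fun k hk => ?_
  rw [mul_eq_zero, frob_eq_zero_iff, adMat_sub, sub_eq_zero]
  tauto

/-- (Z) THE SINGLE-CONTOUR / EQUAL-LETTERS CASE: if all transported letters coincide the defect vanishes (weights summing to `1`) — a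
single-tree slice is unipotent to second order (cf. `Beta.TreeSliceUnipotent`, which proves `|det| = 1` exactly). [folklore] -/
theorem avgDefect_const (τ : C → Matrix (Fin N) (Fin N) ℂ) (s : Finset K) (w : K → ℝ) (X₀ : Matrix (Fin N) (Fin N) ℂ)
    (hw : ∑ k ∈ s, w k = 1) : avgDefect τ s w (fun _ => X₀) = 0 := by
  have hmean : ∑ k ∈ s, w k • X₀ = X₀ := by rw [← Finset.sum_smul, hw, one_smul]
  unfold avgDefect
  rw [hmean, ← Finset.sum_mul, hw, one_mul, sub_self]

end Defect

/-! ## §3 The colour value: minus `2N` × the Killing variance (complete Hermitian family, Hermitian letters, `N ≠ 0`) -/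

section Killing

variable {N : ℕ} {C K : Type*} [Fintype C]

/-- a real weighted mean of Hermitian letters is Hermitian. [folklore] -/
theorem isHermitian_sum_smul (s : Finset K) (w : K → ℝ) (X : K → Matrix (Fin N) (Fin N) ℂ)
    (hX : ∀ k ∈ s, (X k).IsHermitian) : (∑ k ∈ s, w k • X k).IsHermitian := by
  classical
  induction s using Finset.induction_on with
  | empty => simp
  | insert k s hk ih =>
    rw [Finset.sum_insert hk]
    have h1 : (w k • X k).IsHermitian := by
      unfold Matrix.IsHermitian
      rw [Matrix.conjTranspose_smul, star_trivial, (hX k (Finset.mem_insert_self k s)).eq]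
    exact h1.add (ih fun j hj => hX j (Finset.mem_insert_of_mem hj))

/-- (K) **THE COLOUR VALUE**: for Hermitian letters over a complete Hermitian generator family (`N ≠ 0`),
`avgDefect = Σ_k w_k [−2N·Re Tr((X_k − X̄)²) + 2·(Re Tr(X_k − X̄))²]` (`ColourTrace.trace_adMat_mul` termwise). [folklore] -/
theorem avgDefect_eq_killing {τ : C → Matrix (Fin N) (Fin N) ℂ} (hτ : Complete τ) (hH : ∀ c, (τ c).IsHermitian) (hN : N ≠ 0)
    (s : Finset K) (w : K → ℝ) {X : K → Matrix (Fin N) (Fin N) ℂ} (hX : ∀ k ∈ s, (X k).IsHermitian) (hw : ∑ k ∈ s, w k = 1) :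
    avgDefect τ s w X = ∑ k ∈ s, w k *
      (-(2 * N) * ((X k - ∑ j ∈ s, w j • X j) * (X k - ∑ j ∈ s, w j • X j)).trace.re
        + 2 * (X k - ∑ j ∈ s, w j • X j).trace.re * (X k - ∑ j ∈ s, w j • X j).trace.re) := by
  rw [avgDefect_eq_variance τ s w X hw]
  refine Finset.sum_congr rfl fun k hk => ?_
  have hD : (X k - ∑ j ∈ s, w j • X j).IsHermitian := (hX k hk).sub (isHermitian_sum_smul s w X hX)
  rw [trace_adMat_mul hτ hH hN hD hD]

/-- (K) **… FOR TRACELESS LETTERS** (Bałaban's `𝔰𝔲(N)`-valued backgrounds): `avgDefect = −2N·Σ_k w_k Re Tr((X_k − X̄)²)` — minus `2N` ×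
the Killing variance of the transported letters. [folklore] -/
theorem avgDefect_eq_killing_traceless {τ : C → Matrix (Fin N) (Fin N) ℂ} (hτ : Complete τ) (hH : ∀ c, (τ c).IsHermitian)
    (hN : N ≠ 0) (s : Finset K) (w : K → ℝ) {X : K → Matrix (Fin N) (Fin N) ℂ} (hX : ∀ k ∈ s, (X k).IsHermitian)
    (h0 : ∀ k ∈ s, (X k).trace = 0) (hw : ∑ k ∈ s, w k = 1) :
    avgDefect τ s w X = -(2 * N) * ∑ k ∈ s, w k * ((X k - ∑ j ∈ s, w j • X j) * (X k - ∑ j ∈ s, w j • X j)).trace.re := by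
  rw [avgDefect_eq_killing hτ hH hN s w hX hw, Finset.mul_sum]
  refine Finset.sum_congr rfl fun k hk => ?_
  have hmean0 : (∑ j ∈ s, w j • X j).trace = 0 := by
    rw [Matrix.trace_sum]
    refine Finset.sum_eq_zero fun j hj => ?_
    rw [Matrix.trace_smul, h0 j hj, smul_zero]
  have ht : (X k - ∑ j ∈ s, w j • X j).trace = 0 := by rw [Matrix.trace_sub, h0 k hk, hmean0, sub_zero]
  rw [ht, Complex.zero_re]
  ring

/-- the Killing variance term is itself a sum of squares: `Re Tr(H²) = Σ_{ij} |H_{ij}|²  ≥ 0` for Hermitian `H` — so (K) exhibits the sign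
of (V) directly in colour space. [folklore] -/
theorem re_trace_mul_self_nonneg {H : Matrix (Fin N) (Fin N) ℂ} (hH : H.IsHermitian) : 0 ≤ (H * H).trace.re := by
  have h : H * H = Hᴴ * H := by rw [hH.eq]
  have hent : ∀ i j : Fin N, (Hᴴ i j * H j i).re = (H j i).re ^ 2 + (H j i).im ^ 2 := by
    intro i j
    rw [Matrix.conjTranspose_apply, Complex.mul_re, Complex.star_def, Complex.conj_re, Complex.conj_im]
    ring
  rw [h, Matrix.trace]
  simp only [Matrix.diag_apply, Matrix.mul_apply, Complex.re_sum, hent]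
  exact Finset.sum_nonneg fun i _ => Finset.sum_nonneg fun j _ => by positivity

end Killing

/-! ## §4 Instances (non-vacuity of the hypotheses; the two extreme cases) -/

section Examples

/-- the hypotheses of §3 are inhabited: the Pauli family at `N = 2` (`ColourTrace.pauli_complete`, `pauli_isHermitian`). -/
example (s : Finset (Fin 2)) (w : Fin 2 → ℝ) (hw : ∑ k ∈ s, w k = 1) :
    avgDefect pauli s w (fun k => pauli (Fin.castLE (by norm_num) k))
      = -(2 * (2 : ℕ)) * ∑ k ∈ s, w k * ((pauli (Fin.castLE (by norm_num) k) - ∑ j ∈ s, w j • pauli (Fin.castLE (by norm_num) j))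
          * (pauli (Fin.castLE (by norm_num) k) - ∑ j ∈ s, w j • pauli (Fin.castLE (by norm_num) j))).trace.re :=
  avgDefect_eq_killing_traceless pauli_complete pauli_isHermitian (by norm_num) s w (fun k _ => pauli_isHermitian _)
    (fun k _ => pauli_trace _) hw

/-- a single contour (one letter, weight `1`): zero defect, for any family and any letter. -/
example {N : ℕ} {C : Type*} [Fintype C] (τ : C → Matrix (Fin N) (Fin N) ℂ) (X₀ : Matrix (Fin N) (Fin N) ℂ) :
    avgDefect τ (Finset.univ : Finset (Fin 1)) (fun _ => 1) (fun _ => X₀) = 0 :=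
  avgDefect_const τ _ _ X₀ (by simp)

/-- two contours with equal weights `½, ½`: the defect is `−¼‖adMat τ (X₀ − X₁)‖²_F`-type, namely
`−(½‖ad(X₀ − X̄)‖² + ½‖ad(X₁ − X̄)‖²)`, an instance of (V). -/
example {N : ℕ} {C : Type*} [Fintype C] (τ : C → Matrix (Fin N) (Fin N) ℂ) (X : Fin 2 → Matrix (Fin N) (Fin N) ℂ) :
    avgDefect τ Finset.univ (fun _ => (1 / 2 : ℝ)) X
      = -∑ k : Fin 2, (1 / 2 : ℝ) * frob (adMat τ (X k - ∑ j : Fin 2, (1 / 2 : ℝ) • X j)) :=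
  avgDefect_eq_neg_frob τ _ _ X (by norm_num)

end Examples

/-! ## §5 (v1.1) Shift invariance; faithfulness of `ad` (complete family, `N ≠ 0`): equal `ad`-matrices ⇒ equal letters up to a
central part — hence for traceless letters the equality case (Z) of §2 is EQUALITY OF THE TRANSPORTED LETTERS -/

section Faithful

variable {N : ℕ} {C K : Type*} [Fintype C]

/-- (S) **SHIFT INVARIANCE** (weights summing to `1`, nothing else): adding a common letter `Y₀` to every transported letter leaves the
defect unchanged — it sees only the differences `X_k − X̄` (reader's corollary, cell cross-read of v1, pin P3). [folklore] -/
theorem avgDefect_add_const (τ : C → Matrix (Fin N) (Fin N) ℂ) (s : Finset K) (w : K → ℝ) (X : K → Matrix (Fin N) (Fin N) ℂ)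
    (Y₀ : Matrix (Fin N) (Fin N) ℂ) (hw : ∑ k ∈ s, w k = 1) : avgDefect τ s w (fun k => X k + Y₀) = avgDefect τ s w X := by
  have hmean : ∑ j ∈ s, w j • (X j + Y₀) = (∑ j ∈ s, w j • X j) + Y₀ := by
    rw [Finset.sum_congr rfl fun j _ => smul_add (w j) (X j) Y₀, Finset.sum_add_distrib, ← Finset.sum_smul, hw, one_smul]
  rw [avgDefect_eq_neg_frob τ s w _ hw, avgDefect_eq_neg_frob τ s w X hw]
  simp only [hmean, add_sub_add_right_eq_sub]

omit [Fintype C] in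
/-- `i[X − Y, Z] = i[X, Z] − i[Y, Z]`. [folklore] -/
theorem ibr_sub_left (X Y Z : Matrix (Fin N) (Fin N) ℂ) : ibr (X - Y) Z = ibr X Z - ibr Y Z := by
  simp only [ibr, Matrix.sub_mul, Matrix.mul_sub, ← smul_sub]
  congr 1
  abel

/-- equal adjoint-action matrices ⇒ the difference of the letters commutes with every generator (complete family, `N ≠ 0`;
coordinate reading `ColourTrace.ibr_gen_eq_sum`). [folklore] -/
theorem ibr_gen_eq_zero_of_adMatC_eq {τ : C → Matrix (Fin N) (Fin N) ℂ} (hτ : Complete τ) (hN : N ≠ 0)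
    {X Y : Matrix (Fin N) (Fin N) ℂ} (h : adMatC τ X = adMatC τ Y) (d : C) : ibr (X - Y) (τ d) = 0 := by
  rw [ibr_sub_left, ibr_gen_eq_sum hτ hN X d, ibr_gen_eq_sum hτ hN Y d, h, sub_self]

/-- a letter commuting with every generator of a complete family commutes with EVERY matrix (`N ≠ 0`): the generators expand the
traceless matrices (`ColourTrace.expansion_of_complete`) and everything commutes with the scalar part. [folklore] -/
theorem commute_of_ibr_gen_eq_zero {τ : C → Matrix (Fin N) (Fin N) ℂ} (hτ : Complete τ) (hN : N ≠ 0)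
    {D : Matrix (Fin N) (Fin N) ℂ} (h : ∀ d, ibr D (τ d) = 0) (W : Matrix (Fin N) (Fin N) ℂ) : D * W = W * D := by
  have hN' : (N : ℂ) ≠ 0 := Nat.cast_ne_zero.mpr hN
  have hgen : ∀ d, D * τ d = τ d * D := by
    intro d
    have h1 : Complex.I • (D * τ d - τ d * D) = 0 := h d
    rcases smul_eq_zero.mp h1 with hI | hI
    · exact absurd hI Complex.I_ne_zero
    · exact sub_eq_zero.mp hI
  -- the traceless part of `W`
  set Z : Matrix (Fin N) (Fin N) ℂ := W - (W.trace / N) • (1 : Matrix (Fin N) (Fin N) ℂ) with hZ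
  have hZ0 : Z.trace = 0 := by
    rw [hZ, Matrix.trace_sub, Matrix.trace_smul, Matrix.trace_one, Fintype.card_fin, smul_eq_mul, div_mul_cancel₀ _ hN',
      sub_self]
  have hexp := expansion_of_complete hτ hZ0
  have hDZ : (N : ℂ) • (D * Z) = (N : ℂ) • (Z * D) := by
    rw [← Matrix.mul_smul, ← hexp, Matrix.mul_sum, ← Matrix.smul_mul, ← hexp, Matrix.sum_mul]
    refine Finset.sum_congr rfl fun d _ => ?_
    rw [Matrix.mul_smul, Matrix.smul_mul, hgen d]
  have hDZ' : D * Z = Z * D := smul_right_injective _ hN' hDZ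
  have hW : W = Z + (W.trace / N) • (1 : Matrix (Fin N) (Fin N) ℂ) := by rw [hZ]; abel
  rw [hW, Matrix.mul_add, Matrix.add_mul, hDZ', Matrix.mul_smul, Matrix.smul_mul, Matrix.mul_one, Matrix.one_mul]

/-- … hence it is a SCALAR matrix (Mathlib `Matrix.mem_range_scalar_iff_commute_single'`). [folklore] -/
theorem exists_eq_smul_one_of_ibr_gen_eq_zero {τ : C → Matrix (Fin N) (Fin N) ℂ} (hτ : Complete τ) (hN : N ≠ 0)
    {D : Matrix (Fin N) (Fin N) ℂ} (h : ∀ d, ibr D (τ d) = 0) : ∃ c : ℂ, D = c • (1 : Matrix (Fin N) (Fin N) ℂ) := by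
  have hmem : D ∈ Set.range (Matrix.scalar (Fin N)) :=
    Matrix.mem_range_scalar_iff_commute_single'.mpr fun i j => (commute_of_ibr_gen_eq_zero hτ hN h _).symm
  obtain ⟨c, hc⟩ := hmem
  refine ⟨c, ?_⟩
  rw [← hc, Matrix.scalar_apply, Matrix.smul_one_eq_diagonal]

/-- … and it VANISHES if it is traceless. [folklore] -/
theorem eq_zero_of_ibr_gen_eq_zero {τ : C → Matrix (Fin N) (Fin N) ℂ} (hτ : Complete τ) (hN : N ≠ 0)
    {D : Matrix (Fin N) (Fin N) ℂ} (h : ∀ d, ibr D (τ d) = 0) (h0 : D.trace = 0) : D = 0 := by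
  obtain ⟨c, hc⟩ := exists_eq_smul_one_of_ibr_gen_eq_zero hτ hN h
  have hN' : (N : ℂ) ≠ 0 := Nat.cast_ne_zero.mpr hN
  have hc0 : c = 0 := by
    rw [hc, Matrix.trace_smul, Matrix.trace_one, Fintype.card_fin, smul_eq_mul] at h0
    rcases mul_eq_zero.mp h0 with h1 | h1
    · exact h1
    · exact absurd h1 hN'
  rw [hc, hc0, zero_smul]

/-- **FAITHFULNESS OF `ad` ON LETTERS OF EQUAL TRACE** (complete family, `N ≠ 0`): `adMatC τ X = adMatC τ Y` and `Tr X = Tr Y` ⇒ `X = Y`.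
[folklore] -/
theorem eq_of_adMatC_eq {τ : C → Matrix (Fin N) (Fin N) ℂ} (hτ : Complete τ) (hN : N ≠ 0) {X Y : Matrix (Fin N) (Fin N) ℂ}
    (h : adMatC τ X = adMatC τ Y) (ht : X.trace = Y.trace) : X = Y := by
  have h0 : (X - Y).trace = 0 := by rw [Matrix.trace_sub, ht, sub_self]
  exact sub_eq_zero.mp (eq_zero_of_ibr_gen_eq_zero hτ hN (ibr_gen_eq_zero_of_adMatC_eq hτ hN h) h0)

/-- real form: for Hermitian letters and Hermitian generators the REAL matrices `adMat` already determine the letters of equal trace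
(`ColourTrace.adMat_coe`). [folklore] -/
theorem eq_of_adMat_eq {τ : C → Matrix (Fin N) (Fin N) ℂ} (hτ : Complete τ) (hH : ∀ c, (τ c).IsHermitian) (hN : N ≠ 0)
    {X Y : Matrix (Fin N) (Fin N) ℂ} (hX : X.IsHermitian) (hY : Y.IsHermitian) (h : adMat τ X = adMat τ Y)
    (ht : X.trace = Y.trace) : X = Y := by
  refine eq_of_adMatC_eq hτ hN ?_ ht
  ext c d
  rw [← adMat_coe hH hX, ← adMat_coe hH hY, h]

/-- (Z′) **THE EQUALITY CASE IN LETTERS**: over a complete Hermitian family (`N ≠ 0`), for Hermitian TRACELESS letters and weights `w ≥ 0`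
summing to `1`, `avgDefect = 0` iff every weighted transported letter EQUALS the mean letter — i.e. iff the averaged contours all
transport the same letter. [folklore] -/
theorem avgDefect_eq_zero_iff_letters {τ : C → Matrix (Fin N) (Fin N) ℂ} (hτ : Complete τ) (hH : ∀ c, (τ c).IsHermitian)
    (hN : N ≠ 0) (s : Finset K) (w : K → ℝ) {X : K → Matrix (Fin N) (Fin N) ℂ} (hX : ∀ k ∈ s, (X k).IsHermitian)
    (h0 : ∀ k ∈ s, (X k).trace = 0) (hw : ∑ k ∈ s, w k = 1) (hw0 : ∀ k ∈ s, 0 ≤ w k) :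
    avgDefect τ s w X = 0 ↔ ∀ k ∈ s, w k ≠ 0 → X k = ∑ j ∈ s, w j • X j := by
  rw [avgDefect_eq_zero_iff τ s w X hw hw0]
  have hmean0 : (∑ j ∈ s, w j • X j).trace = 0 := by
    rw [Matrix.trace_sum]
    refine Finset.sum_eq_zero fun j hj => ?_
    rw [Matrix.trace_smul, h0 j hj, smul_zero]
  refine forall₂_congr fun k hk => forall_congr' fun _ => ⟨fun h => ?_, fun h => by rw [← h]⟩
  exact eq_of_adMat_eq hτ hH hN (hX k hk) (isHermitian_sum_smul s w X hX) h (by rw [h0 k hk, hmean0])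

end Faithful

end Literature.MathematicalPhysics.QuantumFieldTheory.Balaban1983to89.Beta.AveragedTransportVariance
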